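import Summits.Ventures.QEC.Census.CertCheckMitm
import Summits.Ventures.QEC.Census.CertCheckBZFast
import HarnessLib

/-!
# The meet-in-the-middle lower-bound replay on the FAST enumeration (`scanF`) — drop-in twin of `CertCheckMitm`

`Census/CertCheckMitm.lean` (qec-search-9, CERT-FORMAT v1 §5.2 / §4 L4) replays the meet-in-the-middle lower bound of a
CSS distance certificate with the structural enumeration `Census.scan`; `Census/CertCheckBZFast.lean` (qec-type-08) gives
the kernel-faster twin `scanF` of that enumeration (primitive recursors, `Nat.xor`; `scanF_eq : scanF = scan`, measured
≈ 1.5× under `decide +kernel`). This file is the one-line combination used by qec-search-7's census-row modules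
(`Census/<Family>/<Code>.lean`, emitter `HOME/census/search-7/emit_row.py`):

* `mitmLowerOKF` — `mitmLowerOK` with both scans by `scanF`; **bridge** `mitmLowerOKF_eq : mitmLowerOKF = mitmLowerOK`
  (argument-wise), so NO new soundness content;
* `DistCert.mitmZF` / `mitmXF` — the side replays against the certificate's own position list `posList n Hsyn` and a
  shipped table `T`, with `mitmZF_eq` / `mitmXF_eq` to `mitmZ` / `mitmX`;
* `DistCert.dZ_code_of_mitmF` / `dX_code_of_mitmF` — the conclusions of `dZ_code_of_mitm` / `dX_code_of_mitm`
  (`(c.code _).dZ = c.dZ`) from the fast verdicts;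
* `SynTree.insB`, `tabScan`, `buildTab pos wb` — the meet-in-the-middle TABLE (CERT-FORMAT §5.2: syndromes of all patterns
  of weight `≤ wb`) BUILT IN THE KERNEL from the position list instead of shipped as a literal (a shipped table of the
  `C(n,2) + n + 1` weight-≤2 patterns is ≈ 60 bytes/node — 240–620 kB for `n = 90…144`, over the gate's 200 kB; built
  in the kernel it costs nothing to ship and ≈ 1–5 s to evaluate). SOUNDNESS NEEDS NOTHING about the builder:
  `mitm_lower_sound` treats the table as an arbitrary `SynTree` (T1 re-finds every tabled pattern), so `insB` is an
  unbalanced search-tree insert with no invariant proved or needed; `DistCert.mitmZB` / `mitmXB` = the fast replays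
  against the built table, `dZ_code_of_mitmB` / `dX_code_of_mitmB` their soundness (through `mitmZF_eq`);
* control (CERT-REQS A1): the `[[4,2,2]]` certificate `certC422` through the fast twins and through the built table
  (Bool verdicts, the built-table distances, and a NEGATIVE control: a non-injective table is rejected), `decide`.

Measured (farm, `decide +kernel`, 2026-08-27, qec-search-7): `(wa, wb) = (3, 2)` with the built table on a census
`n = 54` / `n = 90` code (`d = 6`): 16 s / 82 s per side (26·10³ / 1.2·10⁵ probes against 1 486 / 4 096 tabled
patterns); `(4, 1)` with a 37-node literal table on `n = 36`: 18 s per side (6.7·10⁴ probes).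

Generic; axioms ⊆ {propext, Classical.choice, Quot.sound}; no `native_decide`.
-/

namespace Summit.Ventures.QEC.Census

open Literature.InformationTheory.QuantumCodes

/-- **Fast twin of `mitmLowerOK`**: `wmax = wa + wb`, the shipped position list is `posList n Hsyn`, (T1) every
sub-selection of `≤ wb` positions is tabled under its syndrome, (T3) every sub-selection of `≤ wa` positions probes clean
— both enumerations by `scanF`. (definition) -/
noncomputable def mitmLowerOKF (n : ℕ) (Hsyn : List ℕ) (allow : List ℕ) (wmax wa wb : ℕ) (pos : List (ℕ × ℕ))
    (T : SynTree) : Bool :=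
  (wmax == wa + wb) && (pos == posList n Hsyn) &&
    scanF (tableTest T) pos wb 0 0 && scanF (probeTest T n wmax allow) pos wa 0 0

/-- **Bridge**: the fast twin IS `mitmLowerOK`. -/
theorem mitmLowerOKF_eq (n : ℕ) (Hsyn : List ℕ) (allow : List ℕ) (wmax wa wb : ℕ) (pos : List (ℕ × ℕ))
    (T : SynTree) : mitmLowerOKF n Hsyn allow wmax wa wb pos T = mitmLowerOK n Hsyn allow wmax wa wb pos T := by
  rw [mitmLowerOKF, mitmLowerOK, scanF_eq, scanF_eq]

namespace DistCert

variable (c : DistCert)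

/-- Fast meet-in-the-middle replay of the `Z` side (syndromes by `HX`, allow-list of `sideZ`, `wmax = dZ − 1 = wa + wb`)
over the certificate's own position list `posList n HX` and a shipped table `T`. (definition) -/
noncomputable def mitmZF (wa wb : ℕ) (T : SynTree) : Bool :=
  mitmLowerOKF c.n c.HX (c.sideZ.found.map Prod.fst) (c.dZ - 1) wa wb (posList c.n c.HX) T

/-- Fast meet-in-the-middle replay of the `X` side (roles exchanged). (definition) -/
noncomputable def mitmXF (wa wb : ℕ) (T : SynTree) : Bool :=
  mitmLowerOKF c.n c.HZ (c.sideX.found.map Prod.fst) (c.dX - 1) wa wb (posList c.n c.HZ) T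

/-- **Bridge**, `Z` side: `c.mitmZF wa wb T = c.mitmZ wa wb (posList c.n c.HX) T`. -/
theorem mitmZF_eq (wa wb : ℕ) (T : SynTree) : c.mitmZF wa wb T = c.mitmZ wa wb (posList c.n c.HX) T := by
  rw [mitmZF, mitmZ, mitmLowerOKF_eq]

/-- **Bridge**, `X` side: `c.mitmXF wa wb T = c.mitmX wa wb (posList c.n c.HZ) T`. -/
theorem mitmXF_eq (wa wb : ℕ) (T : SynTree) : c.mitmXF wa wb T = c.mitmX wa wb (posList c.n c.HZ) T := by
  rw [mitmXF, mitmX, mitmLowerOKF_eq]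

/-- **Soundness, `Z` side, fast form**: the structural check and a passing fast `Z`-side mitm replay give `Z`-distance
`c.dZ` (= `dZ_code_of_mitm` through `mitmZF_eq`). (theorem) -/
theorem dZ_code_of_mitmF {wa wb : ℕ} {T : SynTree} (hs : c.checkStructure = true) (hZ : c.mitmZF wa wb T = true) :
    (c.code (c.commOK_of_checkStructure hs)).dZ = c.dZ :=
  c.dZ_code_of_mitm hs ((c.mitmZF_eq wa wb T).symm.trans hZ)

/-- **Soundness, `X` side, fast form**. (theorem) -/
theorem dX_code_of_mitmF {wa wb : ℕ} {T : SynTree} (hs : c.checkStructure = true) (hX : c.mitmXF wa wb T = true) :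
    (c.code (c.commOK_of_checkStructure hs)).dX = c.dX :=
  c.dX_code_of_mitm hs ((c.mitmXF_eq wa wb T).symm.trans hX)

end DistCert


/-- Insert (key `k`, value `v`) into a search tree (no rebalancing; an existing key keeps its value). -/
noncomputable def SynTree.insB (k v : ℕ) (t : SynTree) : SynTree :=
  SynTree.rec (motive := fun _ => SynTree) (SynTree.node SynTree.leaf k v SynTree.leaf)
    (fun l key val r il ir => cond (Nat.blt k key) (SynTree.node il key val r)
      (cond (Nat.blt key k) (SynTree.node l key val ir) (SynTree.node l key val r))) t

/-- Thread a tree through the include/skip enumeration of all sub-selections of `≤ b` positions of `L` from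
`(v, s)`, inserting every end point `(s ↦ v)` (same visiting order as `Census.scan`). -/
noncomputable def tabScan (L : List (ℕ × ℕ)) : ℕ → ℕ → ℕ → SynTree → SynTree :=
  List.rec (motive := fun _ => ℕ → ℕ → ℕ → SynTree → SynTree) (fun _ v s T => SynTree.insB s v T)
    (fun pc _ ih b v s T => Nat.rec (motive := fun _ => SynTree) (SynTree.insB s v T)
        (fun b' _ => ih b' (Nat.xor v pc.1) (Nat.xor s pc.2) (ih (Nat.succ b') v s T)) b) L

/-- The in-kernel meet-in-the-middle table of all patterns of weight `≤ wb` over the position list `pos`. -/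
noncomputable def buildTab (pos : List (ℕ × ℕ)) (wb : ℕ) : SynTree := tabScan pos wb 0 0 SynTree.leaf

namespace DistCert

variable (c : DistCert)

/-- Fast meet-in-the-middle replay of the `Z` side against the table BUILT IN THE KERNEL from the side's own position
list (`buildTab (posList n HX) wb`). (definition) -/
noncomputable def mitmZB (wa wb : ℕ) : Bool := c.mitmZF wa wb (buildTab (posList c.n c.HX) wb)

/-- Fast meet-in-the-middle replay of the `X` side against the kernel-built table. (definition) -/
noncomputable def mitmXB (wa wb : ℕ) : Bool := c.mitmXF wa wb (buildTab (posList c.n c.HZ) wb)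

/-- **Soundness, `Z` side, built-table form**: structural check + passing `mitmZB` give `Z`-distance `c.dZ`. (theorem) -/
theorem dZ_code_of_mitmB {wa wb : ℕ} (hs : c.checkStructure = true) (hZ : c.mitmZB wa wb = true) :
    (c.code (c.commOK_of_checkStructure hs)).dZ = c.dZ :=
  c.dZ_code_of_mitmF hs hZ

/-- **Soundness, `X` side, built-table form**. (theorem) -/
theorem dX_code_of_mitmB {wa wb : ℕ} (hs : c.checkStructure = true) (hX : c.mitmXB wa wb = true) :
    (c.code (c.commOK_of_checkStructure hs)).dX = c.dX :=
  c.dX_code_of_mitmF hs hX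

end DistCert

/-! ## Control (CERT-REQS A1): `[[4,2,2]]` through the fast twins and the built table -/

/-- The `Z` side of `certC422` passes the fast mitm replay (`wa = 1`, `wb = 0`, table = the empty pattern). -/
theorem mitmZF_certC422 : certC422.mitmZF 1 0 treeC422 = true := by decide

/-- The `X` side of `certC422` passes the fast mitm replay. -/
theorem mitmXF_certC422 : certC422.mitmXF 1 0 treeC422 = true := by decide

/-- The `Z` side of `certC422` passes against the kernel-built table with `wb = 0` (table = the empty pattern). -/
theorem mitmZB_certC422 : certC422.mitmZB 1 0 = true := by decide

/-- The `X` side of `certC422` passes against the kernel-built table with `wb = 0` (with `wb = 1` it must FAIL: the four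
columns of `H = [1111]` share one syndrome, so T1 cannot re-find them — `decide` confirms `certC422.mitmXB 0 1 = false`). -/
theorem mitmXB_certC422 : certC422.mitmXB 1 0 = true := by decide

/-- Negative control: a non-injective table is rejected (T1), here the weight-≤1 table of `[1111]`. -/
theorem mitmXB_certC422_wb1 : certC422.mitmXB 0 1 = false := by decide

/-- `d_Z = 2` and `d_X = 2` for the `[[4,2,2]]` control through the built tables (KERNEL, `decide`). -/
theorem dZ_dX_certC422_mitmB :
    (certC422.code (certC422.commOK_of_checkStructure checkStructure_certC422)).dZ = 2 ∧
      (certC422.code (certC422.commOK_of_checkStructure checkStructure_certC422)).dX = 2 :=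
  ⟨certC422.dZ_code_of_mitmB checkStructure_certC422 mitmZB_certC422,
   certC422.dX_code_of_mitmB checkStructure_certC422 mitmXB_certC422⟩

end Summit.Ventures.QEC.Census
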